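import Mathlib
import HarnessLib

/-!
# Crux `FluctuationComparisonRegPrIntL` (stmt-QuantumFields-20520, rung R3), PATH-B organ — «SECOND DIFFERENCES FOR ALL SMALL STEPS BOUND THE MIXED PARTIAL»: the converse
# companion of ✓`hClauseSq_of_curvData` ∕ ✓`hClauseSq_of_curvSquare` — if `|g(s,t) − g(s,0) − g(0,t) + g(0,0)| ≤ K·|s|·|t|` near `(0,0)` and the iterated derivative
# `∂_t ∂_s g (0,0)` exists, then `|∂_t ∂_s g (0,0)| ≤ K` (DEFINITION-FREE; flat-road tool, LEAD №22∕№24)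

Cell `ym3-torus` (YM ladder rung R3 = continuum `SU(2)` Yang–Mills on the three-torus — a RUNG: NOT d = 4, NOT infinite volume, NOT a mass gap, NOT Clay).
Width seat `ym-ust-20520-w3` (gen 27, LEAD-20520 organ-tangent lane); `--kind proof --supports stmt-QuantumFields-20520 --as helper`, count-neutral, no registry ∕ binder ∕
`Lines/` edit, default heartbeats, `autoImplicit false`.  Pure one-variable calculus over Mathlib; no organ object.

WHY.  On the FLAT-POINT road for the (I-curv) group (px19 g22 UV3-NODE §80.9∕§80.10; LEAD №22 (B), RULING №53′) the discharger bounds the gradient slot by the mean-value step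
`∂h∕∂bond (A) = ∫₀¹ D²h(rA)[A, ·] dr` (the flat first variation vanishes: ✓`…OrganTangentFlatAnchorEven.deriv_flatBond_eq_zero`), and needs the seed's scaled pair clause
`|ΔΔ_{b b′} h| ≤ k b b′·(‖v‖∕θ)·(‖v′‖∕θ)` — valid for ALL small moves — turned into a POINTWISE bound on the mixed second derivative along the pair `(b v, b′ v′)`:
`|∂_t ∂_s h(U·e^{sv}@b·e^{tv′}@b′)|_{(0,0)} ≤ k b b′∕θ²`.  That conversion is this file: a second difference dominated by `K|s||t|` for all small `(s,t)` forces `|∂_t∂_s| ≤ K`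
(two passages to the limit; no `C²` hypothesis beyond the existence of the iterated derivative).  The forward direction (derivatives ⟹ second differences) is ✓`abs_rectDiff_le_of_mixedDeriv`.

WHAT.  ★`abs_le_of_hasDerivAt_of_abs_le_mul` (`φ 0 = 0`, `HasDerivAt φ d 0`, `|φ s| ≤ C·|s|` near `0` ⟹ `|d| ≤ C`); ★★`abs_mixedDeriv_le_of_secondDiff`
(`HasDerivAt (g · t) (g₁ t) 0` for `t` near `0`, `HasDerivAt g₁ g₁₂ 0`, `|g s t − g s 0 − g 0 t + g 0 0| ≤ K·|s|·|t|` near `(0,0)` ⟹ `|g₁₂| ≤ K`); ★★`abs_mixedDeriv_le_scaled`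
(the organ's scaled reading: domination `k·(|s|∕θ)·(|t|∕θ)` ⟹ `|g₁₂| ≤ k∕θ²`).

HONEST FRAMING: elementary calculus [folklore]; nothing of Bałaban's analysis is asserted or proved; the seed clause and every organ row are HYPOTHESES ∕ UNDISCHARGED; the five
registered stubs of `Lines/semiclassical_s2beta.lean` (untouched), crux 20520 `FluctuationComparisonRegPrIntL` and `YM3TorusSU2` are NOT proved; rung R3 = SU(2) YM₃ on T³ at fixed
lattice data — NOT d = 4, NOT infinite volume, NOT a mass gap, NOT Clay; the Yang–Mills mass gap is NOT proved.  [folklore]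
-/

set_option autoImplicit false

noncomputable section

namespace Summit.QuantumFields.YangMills.Theorems.OrganTangentMixedDerivOfSecondDiff

open Filter Topology Set

/-- ★ A function vanishing at `0`, differentiable there, and dominated by `C·|s|` near `0` has `|derivative| ≤ C`. [folklore] -/
theorem abs_le_of_hasDerivAt_of_abs_le_mul {φ : ℝ → ℝ} {d C : ℝ} (hφ : HasDerivAt φ d 0) (h0 : φ 0 = 0)
    (hb : ∀ᶠ s in 𝓝 (0 : ℝ), |φ s| ≤ C * |s|) : |d| ≤ C := by
  -- the slope tends to `d` along the punctured neighbourhood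
  have ht : Tendsto (fun s => s⁻¹ • (φ (0 + s) - φ 0)) (𝓝[≠] 0) (𝓝 d) := by
    rw [hasDerivAt_iff_tendsto_slope_zero] at hφ; exact hφ
  have habs : Tendsto (fun s => |s⁻¹ • (φ (0 + s) - φ 0)|) (𝓝[≠] 0) (𝓝 |d|) := (continuous_abs.tendsto d).comp ht
  -- the slope is bounded by `C` there
  have hbd : ∀ᶠ s in 𝓝[≠] (0 : ℝ), |s⁻¹ • (φ (0 + s) - φ 0)| ≤ C := by
    have hb' : ∀ᶠ s in 𝓝[≠] (0 : ℝ), |φ s| ≤ C * |s| := nhdsWithin_le_nhds hb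
    filter_upwards [hb', self_mem_nhdsWithin] with s hs (hs0 : s ≠ 0)
    rw [zero_add, h0, sub_zero, smul_eq_mul, abs_mul, abs_inv]
    have hs1 : 0 < |s| := abs_pos.2 hs0
    calc |s|⁻¹ * |φ s| ≤ |s|⁻¹ * (C * |s|) := by gcongr
      _ = C := by field_simp
  exact le_of_tendsto habs hbd

/-- ★★ **SECOND DIFFERENCES DOMINATE THE MIXED PARTIAL.**  `g : ℝ → ℝ → ℝ` with `s ↦ g s t` differentiable at `0` (derivative `g₁ t`) for every `t` near `0`, `g₁` differentiable at
`0` (derivative `g₁₂`), and `|g s t − g s 0 − g 0 t + g 0 0| ≤ K·|s|·|t|` for `(s,t)` near `(0,0)` ⟹ `|g₁₂| ≤ K`. [folklore] -/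
theorem abs_mixedDeriv_le_of_secondDiff {g : ℝ → ℝ → ℝ} {g₁ : ℝ → ℝ} {g₁₂ K : ℝ}
    (h₁ : ∀ᶠ t in 𝓝 (0 : ℝ), HasDerivAt (fun s => g s t) (g₁ t) 0)
    (h₁₂ : HasDerivAt g₁ g₁₂ 0)
    (hK : ∀ᶠ p in 𝓝 ((0 : ℝ), (0 : ℝ)), |g p.1 p.2 - g p.1 0 - g 0 p.2 + g 0 0| ≤ K * |p.1| * |p.2|) :
    |g₁₂| ≤ K := by
  -- unpack the product neighbourhood
  obtain ⟨ε, hε, hball⟩ := Metric.eventually_nhds_iff.1 hK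
  have h10 : HasDerivAt (fun s => g s 0) (g₁ 0) 0 := h₁.self_of_nhds
  -- step 1: `|g₁ t − g₁ 0| ≤ K·|t|` for `t` near `0`
  have step1 : ∀ᶠ t in 𝓝 (0 : ℝ), |g₁ t - g₁ 0| ≤ (K * |t|) := by
    have hεt : ∀ᶠ t in 𝓝 (0 : ℝ), |t| < ε / 2 := by
      have : Metric.ball (0:ℝ) (ε / 2) ∈ 𝓝 (0:ℝ) := Metric.ball_mem_nhds _ (half_pos hε)
      filter_upwards [this] with t ht
      rwa [Metric.mem_ball, dist_zero_right, Real.norm_eq_abs] at ht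
    filter_upwards [h₁, hεt] with t ht htε
    -- the function `s ↦ g s t − g s 0 − g 0 t + g 0 0`
    have hφ : HasDerivAt (fun s => g s t - g s 0 - g 0 t + g 0 0) (g₁ t - g₁ 0) 0 := by
      have := (ht.sub h10).sub_const (g 0 t)
      simpa using this.add_const (g 0 0)
    refine abs_le_of_hasDerivAt_of_abs_le_mul hφ (by ring) ?_
    have hεs : ∀ᶠ s in 𝓝 (0 : ℝ), |s| < ε / 2 := by
      have : Metric.ball (0:ℝ) (ε / 2) ∈ 𝓝 (0:ℝ) := Metric.ball_mem_nhds _ (half_pos hε)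
      filter_upwards [this] with s hs
      rwa [Metric.mem_ball, dist_zero_right, Real.norm_eq_abs] at hs
    filter_upwards [hεs] with s hs
    have hmem : dist (s, t) ((0 : ℝ), (0 : ℝ)) < ε := by
      rw [Prod.dist_eq, Real.dist_eq, Real.dist_eq, sub_zero, sub_zero]
      exact max_lt (by linarith) (by linarith)
    have := hball hmem
    simp only at this
    calc |g s t - g s 0 - g 0 t + g 0 0| ≤ K * |s| * |t| := this
      _ = K * |t| * |s| := by ring
  -- step 2: `g₁ t − g₁ 0` has derivative `g₁₂` at `0` and is dominated by `K|t|`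
  have hψ : HasDerivAt (fun t => g₁ t - g₁ 0) g₁₂ 0 := by simpa using h₁₂.sub_const (g₁ 0)
  exact abs_le_of_hasDerivAt_of_abs_le_mul hψ (by simp) step1

/-- ★★ **THE ORGAN's SCALED READING**: domination `k·(|s|∕θ)·(|t|∕θ)` (the `HClauseSq` currency with unit direction vectors) ⟹ `|∂_t∂_s g (0,0)| ≤ k∕θ²`. [folklore] -/
theorem abs_mixedDeriv_le_scaled {g : ℝ → ℝ → ℝ} {g₁ : ℝ → ℝ} {g₁₂ k θ : ℝ} (hθ : 0 < θ)
    (h₁ : ∀ᶠ t in 𝓝 (0 : ℝ), HasDerivAt (fun s => g s t) (g₁ t) 0)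
    (h₁₂ : HasDerivAt g₁ g₁₂ 0)
    (hk : ∀ᶠ p in 𝓝 ((0 : ℝ), (0 : ℝ)), |g p.1 p.2 - g p.1 0 - g 0 p.2 + g 0 0| ≤ k * (|p.1| / θ) * (|p.2| / θ)) :
    |g₁₂| ≤ k / θ ^ 2 := by
  refine abs_mixedDeriv_le_of_secondDiff h₁ h₁₂ ?_
  filter_upwards [hk] with p hp
  calc |g p.1 p.2 - g p.1 0 - g 0 p.2 + g 0 0| ≤ k * (|p.1| / θ) * (|p.2| / θ) := hp
    _ = k / θ ^ 2 * |p.1| * |p.2| := by field_simp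

end Summit.QuantumFields.YangMills.Theorems.OrganTangentMixedDerivOfSecondDiff

end
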